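import Mathlib.NumberTheory.Chebyshev
import Mathlib.Analysis.SpecialFunctions.Pow.Real
import Mathlib.Analysis.Complex.ExponentialBounds
import HarnessLib

/-!
# Chebyshev-strength counts of primes in `(y/4, y]`

Topic `Literature/NumberTheory/LFunctions`.  Everything here is PROVED from Mathlib's Chebyshev
bounds `θ(x) ≤ x log 4` (`Chebyshev.theta_le_log4_mul_x`) and
`θ(x) ≥ (x-1) log 2 - log(x+2) - 2√x log x` (`Chebyshev.theta_ge'`):

* `card_quarterPrimes_ge` : for `y ≥ 10¹²`, `#{p prime : y/4 < p ≤ y} ≥ (log 2 / 8) y / log y`;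
* `sum_inv_quarterPrimes_ge` : `∑_{y/4 < p ≤ y} 1/p ≥ (log 2 / 8) / log y`;
* `primeCounting_le_three_mul_div_log` (from Mathlib's `Chebyshev.pi_le_log4_mul_div`),
  `card_primesLE_le_three_mul_div_log` : for `y ≥ 10¹²`, `π(y) ≤ 3 y / log y`;
* `sum_inv_quarterPrimes_le` : `∑_{y/4 < p ≤ y} 1/p ≤ 12 / log y`.

These are the "prime number theorem" inputs of Tao 2016, §§2–3 (Prop. 2.6: "by the prime number
theorem … `∑_{p ∈ 𝒫_H} 1/p ≫ 1/log H`"; Lemma 3.5: "`|𝒫_H| ≪ ε² H / log H`") for the set `𝒫_H` of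
primes of size `≍ ε² H`; with Chebyshev's constants the ratio `4` (rather than the paper's `2`)
between the endpoints is needed for the lower bound.

## References
* P. L. Chebyshev (1852); Mathlib `Mathlib.NumberTheory.Chebyshev`. [folklore]
* T. Tao, Forum Math. Pi 4 (2016) e8, Proposition 2.6 and Lemma 3.5 (where these bounds are used).
-/

open Finset Real

namespace Literature.NumberTheory.LFunctions

namespace PrimeInterval

/-- The primes in `(y/4, y]`. [folklore] -/
noncomputable def quarterPrimes (y : ℝ) : Finset ℕ := Nat.primesLE ⌊y⌋₊ \ Nat.primesLE ⌊y / 4⌋₊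

/-- Membership in `quarterPrimes` (for `y < 0` both sides are false). [folklore] -/
theorem mem_quarterPrimes {y : ℝ} {p : ℕ} :
    p ∈ quarterPrimes y ↔ p.Prime ∧ y / 4 < p ∧ (p : ℝ) ≤ y := by
  unfold quarterPrimes
  rw [Finset.mem_sdiff, Nat.mem_primesLE, Nat.mem_primesLE]
  rcases le_or_gt 0 y with hy | hy
  · constructor
    · rintro ⟨⟨hpy, hp⟩, hnot⟩
      refine ⟨hp, ?_, ?_⟩
      · by_contra h
        push Not at h
        exact hnot ⟨Nat.le_floor h, hp⟩
      · exact le_trans (by exact_mod_cast hpy) (Nat.floor_le hy)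
    · rintro ⟨hp, h1, h2⟩
      refine ⟨⟨Nat.le_floor h2, hp⟩, fun h => ?_⟩
      have : (p : ℝ) ≤ ⌊y / 4⌋₊ := by exact_mod_cast h.1
      linarith [Nat.floor_le (by positivity : 0 ≤ y / 4)]
  · -- `y < 0`: no primes on either side
    rw [Nat.floor_of_nonpos hy.le]
    constructor
    · rintro ⟨⟨hpy, hp⟩, -⟩
      exact absurd (Nat.le_zero.mp hpy ▸ hp) Nat.not_prime_zero
    · rintro ⟨hp, -, h2⟩
      have : (0 : ℝ) < p := by exact_mod_cast hp.pos
      linarith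

/-- `∑_{y/4 < p ≤ y} log p = θ(y) - θ(y/4)`. [folklore] -/
theorem sum_log_quarterPrimes (y : ℝ) :
    ∑ p ∈ quarterPrimes y, Real.log p = Chebyshev.theta y - Chebyshev.theta (y / 4) := by
  have hsub : Nat.primesLE ⌊y / 4⌋₊ ⊆ Nat.primesLE ⌊y⌋₊ := by
    intro p hp
    rw [Nat.mem_primesLE] at hp ⊢
    refine ⟨hp.1.trans ?_, hp.2⟩
    rcases le_or_gt 0 y with hy | hy
    · exact Nat.floor_le_floor (by linarith)
    · rw [Nat.floor_of_nonpos (by linarith : y / 4 ≤ 0)]; exact Nat.zero_le _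
  rw [Chebyshev.theta_eq_sum_primesLE, Chebyshev.theta_eq_sum_primesLE, quarterPrimes,
    ← Finset.sum_sdiff hsub, add_sub_cancel_right]

/-- Numerics: for `y ≥ 10¹²`, `log 2 + log (y+2) + 2 √y log y ≤ (log 2 / 8) y` and
`√y ≤ y / (5 log y)`. [folklore] -/
private theorem numerics {y : ℝ} (hy : (10 : ℝ) ^ 12 ≤ y) :
    Real.log 2 + Real.log (y + 2) + 2 * Real.sqrt y * Real.log y ≤ Real.log 2 / 8 * y ∧
      Real.sqrt y * Real.log y ≤ y / 5 := by
  have hy0 : 0 < y := lt_of_lt_of_le (by norm_num) hy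
  have hy1 : 1 ≤ y := le_trans (by norm_num) hy
  have hl2 := Real.log_two_gt_d9
  have hl2' := Real.log_two_lt_d9
  -- `t = y^{1/4} ≥ 1000`
  set t : ℝ := y ^ (1 / 4 : ℝ) with ht
  have ht0 : 0 < t := Real.rpow_pos_of_pos hy0 _
  have ht4 : t ^ (4 : ℕ) = y := by
    rw [ht, ← Real.rpow_natCast, ← Real.rpow_mul hy0.le]; norm_num
  have ht1000 : 1000 ≤ t := by
    have h1 : ((1000 : ℝ) ^ (4 : ℕ)) ^ (1 / 4 : ℝ) ≤ y ^ (1 / 4 : ℝ) :=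
      Real.rpow_le_rpow (by norm_num) (by norm_num; linarith) (by norm_num)
    rw [← Real.rpow_natCast, ← Real.rpow_mul (by norm_num)] at h1
    norm_num at h1
    exact h1
  have hsqrt : Real.sqrt y = t ^ 2 := by
    rw [Real.sqrt_eq_iff_mul_self_eq_of_pos (by positivity), ← ht4]; ring
  -- `log y ≤ 4 t`
  have hlogy : Real.log y ≤ 4 * t := by
    have := Real.log_le_rpow_div hy0.le (by norm_num : (0 : ℝ) < 1 / 4)
    rw [← ht] at this
    linarith
  have hlogy0 : 0 ≤ Real.log y := Real.log_nonneg hy1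
  -- `log (y + 2) ≤ log 2 + log y`
  have hlog2y : Real.log (y + 2) ≤ Real.log 2 + Real.log y := by
    rw [← Real.log_mul (by norm_num) hy0.ne']
    exact Real.log_le_log (by linarith) (by linarith)
  have ht1 : 1 ≤ t := by linarith
  have ht3 : t ≤ t ^ 3 := by nlinarith
  have ht3pos : 0 < t ^ 3 := by positivity
  have h1 : t ^ 2 * Real.log y ≤ 4 * t ^ 3 := by nlinarith
  constructor
  · -- `2 log 2 + 4t + 8 t³ ≤ 86 t³ ≤ (log 2 / 8) t⁴ = (log 2 / 8) y`
    rw [hsqrt]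
    have h5 : 86 * t ^ 3 ≤ Real.log 2 / 8 * y := by
      rw [← ht4]
      have : (1000 : ℝ) * t ^ 3 ≤ t ^ 4 := by nlinarith
      nlinarith
    nlinarith
  · rw [hsqrt]
    have h7 : 4 * t ^ 3 ≤ y / 5 := by
      rw [← ht4]
      nlinarith
    linarith

/-- **Primes in `(y/4, y]`, lower bound**: `∑_{y/4 < p ≤ y} log p ≥ (log 2 / 8) y` for
`y ≥ 10¹²`. [folklore] -/
theorem sum_log_quarterPrimes_ge {y : ℝ} (hy : (10 : ℝ) ^ 12 ≤ y) :
    Real.log 2 / 8 * y ≤ ∑ p ∈ quarterPrimes y, Real.log p := by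
  have hy0 : 0 < y := lt_of_lt_of_le (by norm_num) hy
  have hy1 : 1 ≤ y := le_trans (by norm_num) hy
  rw [sum_log_quarterPrimes y]
  have h1 := Chebyshev.theta_ge' hy1
  have h2 : Chebyshev.theta (y / 4) ≤ Real.log 4 * (y / 4) :=
    Chebyshev.theta_le_log4_mul_x (by positivity)
  have hlog4 : Real.log 4 = 2 * Real.log 2 := by
    rw [show (4 : ℝ) = 2 ^ 2 by norm_num, Real.log_pow]; norm_num
  have h3 := (numerics hy).1
  rw [hlog4] at h2
  have h4 : 0 ≤ y * Real.log 2 := mul_nonneg hy0.le (Real.log_nonneg one_le_two)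
  linarith

/-- **Primes in `(y/4, y]`, lower count**: `#{y/4 < p ≤ y} ≥ (log 2 / 8) y / log y` for
`y ≥ 10¹²`. [folklore] -/
theorem card_quarterPrimes_ge {y : ℝ} (hy : (10 : ℝ) ^ 12 ≤ y) :
    Real.log 2 / 8 * y / Real.log y ≤ #(quarterPrimes y) := by
  have hy0 : 0 < y := lt_of_lt_of_le (by norm_num) hy
  have hlogy : 0 < Real.log y := Real.log_pos (lt_of_lt_of_le (by norm_num) hy)
  rw [div_le_iff₀ hlogy]
  calc Real.log 2 / 8 * y ≤ ∑ p ∈ quarterPrimes y, Real.log p := sum_log_quarterPrimes_ge hy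
    _ ≤ ∑ p ∈ quarterPrimes y, Real.log y := by
        refine Finset.sum_le_sum fun p hp => ?_
        obtain ⟨hp', -, hpy⟩ := mem_quarterPrimes.mp hp
        exact Real.log_le_log (by exact_mod_cast hp'.pos) hpy
    _ = #(quarterPrimes y) * Real.log y := by rw [Finset.sum_const, nsmul_eq_mul]

/-- **`∑_{y/4 < p ≤ y} 1/p ≥ (log 2 / 8) / log y`** for `y ≥ 10¹²` (Tao 2016, proof of Prop. 2.6:
"by the prime number theorem … `∑_{p ∈ 𝒫_H} 1/p ≫ 1/log H`"). [folklore] -/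
theorem sum_inv_quarterPrimes_ge {y : ℝ} (hy : (10 : ℝ) ^ 12 ≤ y) :
    Real.log 2 / 8 / Real.log y ≤ ∑ p ∈ quarterPrimes y, (1 : ℝ) / p := by
  have hy0 : 0 < y := lt_of_lt_of_le (by norm_num) hy
  have hlogy : 0 < Real.log y := Real.log_pos (lt_of_lt_of_le (by norm_num) hy)
  have h1 := card_quarterPrimes_ge hy
  calc Real.log 2 / 8 / Real.log y = (Real.log 2 / 8 * y / Real.log y) * (1 / y) := by
        field_simp
    _ ≤ #(quarterPrimes y) * (1 / y) := mul_le_mul_of_nonneg_right h1 (by positivity)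
    _ = ∑ p ∈ quarterPrimes y, (1 : ℝ) / y := by rw [Finset.sum_const, nsmul_eq_mul]
    _ ≤ ∑ p ∈ quarterPrimes y, (1 : ℝ) / p := by
        refine Finset.sum_le_sum fun p hp => ?_
        obtain ⟨hp', -, hpy⟩ := mem_quarterPrimes.mp hp
        exact one_div_le_one_div_of_le (by exact_mod_cast hp'.pos) hpy

/-- **Chebyshev's upper bound for `π(y)`** in the form `π(y) ≤ 3 y / log y` for `y ≥ 10¹²`, from
Mathlib's `Chebyshev.pi_le_log4_mul_div` (`π ⌊x⌋₊ ≤ x log 4 / log √x + √x`) and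
`√y ≤ y/(5 log y)`. [folklore] -/
theorem primeCounting_le_three_mul_div_log {y : ℝ} (hy : (10 : ℝ) ^ 12 ≤ y) :
    (Nat.primeCounting ⌊y⌋₊ : ℝ) ≤ 3 * y / Real.log y := by
  have hy0 : 0 < y := lt_of_lt_of_le (by norm_num) hy
  have hy1 : 1 < y := lt_of_lt_of_le (by norm_num) hy
  have hlogy : 0 < Real.log y := Real.log_pos hy1
  have h1 := Chebyshev.pi_le_log4_mul_div hy1
  rw [Real.log_sqrt hy0.le] at h1
  have hlog4 : Real.log 4 ≤ 7 / 5 := by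
    rw [show (4 : ℝ) = 2 ^ 2 by norm_num, Real.log_pow]
    have := Real.log_two_lt_d9; push_cast; linarith
  have hsqrt := (numerics hy).2
  have hs_le : Real.sqrt y ≤ y / (5 * Real.log y) := by
    rw [le_div_iff₀ (by positivity)]; nlinarith
  have h2 : Real.log 4 * y / (Real.log y / 2) ≤ (14 / 5) * y / Real.log y := by
    rw [div_div_eq_mul_div]
    have e : Real.log 4 * y * 2 / Real.log y = (2 * Real.log 4) * y / Real.log y := by ring
    rw [e]
    refine div_le_div_of_nonneg_right ?_ hlogy.le
    nlinarith
  have e1 : (14 / 5 : ℝ) * y / Real.log y + y / (5 * Real.log y) = 3 * y / Real.log y := by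
    field_simp; ring
  linarith

/-- `#{p ≤ y} ≤ 3 y / log y` for `y ≥ 10¹²` (Finset form of the previous bound). [folklore] -/
theorem card_primesLE_le_three_mul_div_log {y : ℝ} (hy : (10 : ℝ) ^ 12 ≤ y) :
    (#(Nat.primesLE ⌊y⌋₊) : ℝ) ≤ 3 * y / Real.log y := by
  rw [Nat.primesLE_card_eq_primeCounting]
  exact primeCounting_le_three_mul_div_log hy

/-- **`∑_{y/4 < p ≤ y} 1/p ≤ 12 / log y`** for `y ≥ 10¹²` (each term is `< 4/y` and there are at
most `π(y) ≤ 3y/log y` of them; Tao 2016, Lemma 3.5: "`|𝒫_H| ≪ ε² H / log H`"). [folklore] -/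
theorem sum_inv_quarterPrimes_le {y : ℝ} (hy : (10 : ℝ) ^ 12 ≤ y) :
    ∑ p ∈ quarterPrimes y, (1 : ℝ) / p ≤ 12 / Real.log y := by
  have hy0 : 0 < y := lt_of_lt_of_le (by norm_num) hy
  have hlogy : 0 < Real.log y := Real.log_pos (lt_of_lt_of_le (by norm_num) hy)
  calc ∑ p ∈ quarterPrimes y, (1 : ℝ) / p ≤ ∑ p ∈ quarterPrimes y, (4 : ℝ) / y := by
        refine Finset.sum_le_sum fun p hp => ?_
        obtain ⟨hp', hyp, -⟩ := mem_quarterPrimes.mp hp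
        have hp0 : (0 : ℝ) < p := by exact_mod_cast hp'.pos
        rw [div_le_div_iff₀ hp0 hy0]
        linarith
    _ = #(quarterPrimes y) * (4 / y) := by rw [Finset.sum_const, nsmul_eq_mul]
    _ ≤ #(Nat.primesLE ⌊y⌋₊) * (4 / y) := by
        refine mul_le_mul_of_nonneg_right ?_ (by positivity)
        exact_mod_cast Finset.card_le_card Finset.sdiff_subset
    _ ≤ (3 * y / Real.log y) * (4 / y) :=
        mul_le_mul_of_nonneg_right (card_primesLE_le_three_mul_div_log hy) (by positivity)
    _ = 12 / Real.log y := by field_simp; ring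

/-- **`#{y/4 < p ≤ y} ≤ 3 y / log y`** for `y ≥ 10¹²`. [folklore] -/
theorem card_quarterPrimes_le {y : ℝ} (hy : (10 : ℝ) ^ 12 ≤ y) :
    (#(quarterPrimes y) : ℝ) ≤ 3 * y / Real.log y :=
  le_trans (by exact_mod_cast Finset.card_le_card Finset.sdiff_subset)
    (card_primesLE_le_three_mul_div_log hy)

end PrimeInterval

end Literature.NumberTheory.LFunctions
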